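/-
Copyright (c) 2026 the pub-hodgecm-mathlib formalisation cell (harness21).  Prover seat hodgecm-mathlib-K2E4-p03 (g2), Track B «K2-LIT» ∕ h413
(`stmt-HodgeConjecture-24833`), line `K2_E3_EllipticInputs`, unit U3b, ROAD J of ‹S_loc›, letter J3 «rank-one mass», brick R2: THE EP VALUE IN INDEX FORM.  2026-09-04.
-/
import Literature.NumberTheory.Weil1982.UnitaryFinTopFormTransport   -- ★ `measure_coe_eq_relIndex_mul`, `relIndex_ne_zero_of_isCompact_of_isOpen` (generic topological-group index ∕ Haar bookkeeping)
import HarnessLib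

/-!
# K2_E3 road (h413), U3b ROAD J, letter J3 «rank-one mass» — brick R2: THE VALUE OF AN EULER–POINCARÉ COMBINATION IN INDEX FORM
# `f(g)·ν(K₀) = Σ_σ c_σ·[K_σ : K₀]⁻¹` for `g ∈ ⋂ K_σ` (Kottwitz 1988 §2; Rogawski 1990 §12.6 p. 174)

Cell `pub/hodgecm-mathlib` (D-0151), Track B; dealt BY NAME (line lead K2E4-p06 (g2) 00:09:04Z (B); dealer K2E3-plan (g2) 00:23:22Z) from K2E4-p04 (g2)'s
`MEMO-J3-CompatibleMeasureEPIdentityRankOne` §3: «R2 (S–M) EP VALUE IN INDEX FORM: for the explicit three-term `f = Σ ±𝟙_{K_σ}∕ν(K_σ)` (J2♯'s output, K2E4-p08) and ANY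
Haar `ν`, `f(1)·ν(K′) = Σ_σ ±[K_σ : K′]⁻¹` for any compact open `K′ ≤ ⋂ K_σ` — pure index algebra over ★ `measure_coe_eq_relIndex_mul`» (R1 = ★ p855499
`UnitaryFinTopFormLevelMass`).  PURE TOPOLOGICAL-GROUP BOOKKEEPING (any group `G`, any left-invariant `ν` finite on compacts and positive on opens; no unitary group, no tree):
* §1 `toReal_measure_pos_of_isOpen_isCompact`, `toReal_measure_coe_eq_relIndex_mul`, `inv_toReal_measure_mul_toReal_measure` — `ν(K) = [K : K₀]·ν(K₀)` read in `ℝ` and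
  `((ν K).toReal : ℂ)⁻¹ · (ν K₀).toReal = ([K : K₀] : ℂ)⁻¹` for compact open subgroups `K₀ ≤ K`.
* §2 `sum_indicator_div_measure_apply_mul` — GENERAL FORM: for a finite family of compact open subgroups `K_σ`, coefficients `c_σ : ℂ`, a compact open `K₀ ≤ K_σ` and any
  `g ∈ ⋂ K_σ`: `(Σ_σ c_σ·((ν K_σ).toReal)⁻¹·𝟙_{K_σ}(g)) · (ν K₀).toReal = Σ_σ c_σ·([K_σ : K₀] : ℂ)⁻¹`.
* §3 `epCombination_apply_mul_toReal_measure` — the THREE-TERM shape of ★ `isLocSmooth_epCombination` ∕ ★ `classOrbitalIntegral_epCombination_eq_of_compactSpace`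
  (`RankOneEulerPoincareGlue`) VERBATIM: for `g ∈ K ⊓ K′ ⊓ I` (so `g = 1`, or the central `z` of ★ `rankOneEulerPoincareNonsplit_withCentralValue`),
  `f(g)·(ν K₀).toReal = [K:K₀]⁻¹ + [K′:K₀]⁻¹ − [I:K₀]⁻¹`; `neg_r_mul_toReal_measure_of_epCombination_apply` — if `f z = −r` then `r·(ν K₀).toReal = [I:K₀]⁻¹ − [K:K₀]⁻¹ − [K′:K₀]⁻¹`.
THEOREMS ONLY; lane `--supports stmt-HodgeConjecture-24833 --as helper`.  HONEST LABEL: HC_CM is proved only modulo the 7 printed citations (2 remaining named inputs: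
hLiu418 = stmt-HodgeConjecture-24832, h413 = stmt-HodgeConjecture-24833) until rung 0 closes; count-neutral helper (R3 «the two numbers» is the open core of J3).

## References
* [Kottwitz1988] R. E. Kottwitz, *Tamagawa numbers*, Ann. of Math. 127 (1988) 629–646: §1 (EP measure compatible across inner forms), §2 Theorem 2.
* [Rogawski1990] J. D. Rogawski, *Automorphic Representations of Unitary Groups in Three Variables*, Ann. of Math. Stud. 123 (1990), §8.1 p. 117 («d(j) independent of j»); §12.6 p. 174.
* [DeitmarEchterhoff2014] A. Deitmar, S. Echterhoff, *Principles of Harmonic Analysis*, 2nd ed. (2014), Thm. 1.5.3 (index = ratio of Haar measures).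
-/

set_option autoImplicit false
-- the mandated namespace repeats the single-problem summit's segment (`HodgeConjecture.HodgeConjecture`), as in every `Theorems/*.lean` of this sub-problem
set_option linter.dupNamespace false

noncomputable section

open MeasureTheory
open scoped ENNReal NNReal
open Literature.NumberTheory.Weil1982.UnitaryFinTopForm

namespace Summit.HodgeConjecture.HodgeConjecture.Cruxes.H413.K2E3EPValueIndexForm

variable {G : Type*} [Group G] [TopologicalSpace G] [IsTopologicalGroup G] [MeasurableSpace G] [BorelSpace G]
variable (ν : Measure G) [ν.IsMulLeftInvariant] [IsFiniteMeasureOnCompacts ν] [ν.IsOpenPosMeasure]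

/-! ## §1 `ν(K) = [K : K₀]·ν(K₀)` in `ℝ` and the inverse-volume identity -/

omit [IsTopologicalGroup G] [BorelSpace G] [ν.IsMulLeftInvariant] in
/-- A compact open subgroup has volume in `(0, ∞)`: `0 < (ν K).toReal`. [cite: DeitmarEchterhoff2014, Thm. 1.5.3] -/
theorem toReal_measure_pos_of_isOpen_isCompact (K : Subgroup G) (hKo : IsOpen (K : Set G)) (hKc : IsCompact (K : Set G)) : 0 < (ν (K : Set G)).toReal :=
  ENNReal.toReal_pos (hKo.measure_pos ν ⟨1, K.one_mem⟩).ne' hKc.measure_lt_top.ne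

omit [IsFiniteMeasureOnCompacts ν] [ν.IsOpenPosMeasure] in
/-- **`(ν K).toReal = [K : K₀] · (ν K₀).toReal`** for compact open subgroups `K₀ ≤ K` (the index is finite: ★ `relIndex_ne_zero_of_isCompact_of_isOpen`).
[cite: DeitmarEchterhoff2014, Thm. 1.5.3] -/
theorem toReal_measure_coe_eq_relIndex_mul (K K₀ : Subgroup G) (hK₀K : K₀ ≤ K) (hKo : IsOpen (K : Set G)) (hKc : IsCompact (K : Set G)) (hK₀o : IsOpen (K₀ : Set G)) :
    (ν (K : Set G)).toReal = (K₀.relIndex K : ℝ) * (ν (K₀ : Set G)).toReal := by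
  rw [measure_coe_eq_relIndex_mul ν K K₀ hK₀K hKo.measurableSet hK₀o.measurableSet (relIndex_ne_zero_of_isCompact_of_isOpen K K₀ hKc hK₀o),
    ENNReal.toReal_mul, ENNReal.toReal_natCast]

/-- **`((ν K).toReal : ℂ)⁻¹ · (ν K₀).toReal = ([K : K₀] : ℂ)⁻¹`** for compact open subgroups `K₀ ≤ K`. [cite: Kottwitz1988, §2] [cite: DeitmarEchterhoff2014, Thm. 1.5.3] -/
theorem inv_toReal_measure_mul_toReal_measure (K K₀ : Subgroup G) (hK₀K : K₀ ≤ K) (hKo : IsOpen (K : Set G)) (hKc : IsCompact (K : Set G))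
    (hK₀o : IsOpen (K₀ : Set G)) (hK₀c : IsCompact (K₀ : Set G)) :
    (((ν (K : Set G)).toReal : ℂ))⁻¹ * ((ν (K₀ : Set G)).toReal : ℂ) = ((K₀.relIndex K : ℕ) : ℂ)⁻¹ := by
  have h0 : ((ν (K₀ : Set G)).toReal : ℂ) ≠ 0 := Complex.ofReal_ne_zero.2 (toReal_measure_pos_of_isOpen_isCompact ν K₀ hK₀o hK₀c).ne'
  rw [toReal_measure_coe_eq_relIndex_mul ν K K₀ hK₀K hKo hKc hK₀o, Complex.ofReal_mul, Complex.ofReal_natCast, mul_inv, mul_assoc, inv_mul_cancel₀ h0, mul_one]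

/-! ## §2 The general index form -/

/-- **GENERAL INDEX FORM**: for a finite family of compact open subgroups `K_σ` (`σ ∈ s`), coefficients `c_σ : ℂ`, a compact open subgroup `K₀ ≤ K_σ` (`σ ∈ s`) and any
`g ∈ ⋂_σ K_σ`: `(Σ_σ c_σ · ((ν K_σ).toReal)⁻¹ · 𝟙_{K_σ}(g)) · (ν K₀).toReal = Σ_σ c_σ · ([K_σ : K₀] : ℂ)⁻¹` — the value of a general Euler–Poincaré-type combination at a
common element, freed of the Haar measure. [cite: Kottwitz1988, §2 Theorem 2] [cite: Rogawski1990, §12.6 p. 174] -/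
theorem sum_indicator_div_measure_apply_mul {ι : Type*} (s : Finset ι) (K : ι → Subgroup G) (c : ι → ℂ) (K₀ : Subgroup G)
    (hKo : ∀ σ ∈ s, IsOpen (K σ : Set G)) (hKc : ∀ σ ∈ s, IsCompact (K σ : Set G)) (hK₀o : IsOpen (K₀ : Set G)) (hK₀c : IsCompact (K₀ : Set G))
    (hle : ∀ σ ∈ s, K₀ ≤ K σ) {g : G} (hg : ∀ σ ∈ s, g ∈ K σ) :
    (∑ σ ∈ s, c σ * (((ν (K σ : Set G)).toReal : ℂ))⁻¹ * (K σ : Set G).indicator (fun _ => (1 : ℂ)) g) * ((ν (K₀ : Set G)).toReal : ℂ) =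
      ∑ σ ∈ s, c σ * ((K₀.relIndex (K σ) : ℕ) : ℂ)⁻¹ := by
  rw [Finset.sum_mul]
  refine Finset.sum_congr rfl fun σ hσ => ?_
  rw [Set.indicator_of_mem (hg σ hσ), mul_one, mul_assoc, inv_toReal_measure_mul_toReal_measure ν (K σ) K₀ (hle σ hσ) (hKo σ hσ) (hKc σ hσ) hK₀o hK₀c]

/-! ## §3 The three-term Euler–Poincaré combination of the rank-one tree -/

/-- **THE EP VALUE IN INDEX FORM (three-term shape of ★ `isLocSmooth_epCombination`)**: for compact open subgroups `K, K′, I` and `K₀ ≤ K ⊓ K′ ⊓ I`, and `g ∈ K ⊓ K′ ⊓ I`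
(e.g. `g = 1`, or a central element of all three stabilisers),
`(ν(K)⁻¹𝟙_K(g) + ν(K′)⁻¹𝟙_{K′}(g) − ν(I)⁻¹𝟙_I(g)) · ν(K₀) = [K:K₀]⁻¹ + [K′:K₀]⁻¹ − [I:K₀]⁻¹` (read in `ℂ` through `toReal`, the currency of the tree's EP files).
[cite: Kottwitz1988, §2 Theorem 2] [cite: Rogawski1990, §12.6 p. 174] -/
theorem epCombination_apply_mul_toReal_measure (K K' I K₀ : Subgroup G)
    (hKo : IsOpen (K : Set G)) (hKc : IsCompact (K : Set G)) (hK'o : IsOpen (K' : Set G)) (hK'c : IsCompact (K' : Set G))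
    (hIo : IsOpen (I : Set G)) (hIc : IsCompact (I : Set G)) (hK₀o : IsOpen (K₀ : Set G)) (hK₀c : IsCompact (K₀ : Set G))
    (hK₀K : K₀ ≤ K) (hK₀K' : K₀ ≤ K') (hK₀I : K₀ ≤ I) {g : G} (hgK : g ∈ K) (hgK' : g ∈ K') (hgI : g ∈ I) :
    ((((ν (K : Set G)).toReal : ℂ))⁻¹ * (K : Set G).indicator (fun _ => (1 : ℂ)) g + (((ν (K' : Set G)).toReal : ℂ))⁻¹ * (K' : Set G).indicator (fun _ => (1 : ℂ)) g -
        (((ν (I : Set G)).toReal : ℂ))⁻¹ * (I : Set G).indicator (fun _ => (1 : ℂ)) g) * ((ν (K₀ : Set G)).toReal : ℂ) =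
      ((K₀.relIndex K : ℕ) : ℂ)⁻¹ + ((K₀.relIndex K' : ℕ) : ℂ)⁻¹ - ((K₀.relIndex I : ℕ) : ℂ)⁻¹ := by
  rw [Set.indicator_of_mem hgK, Set.indicator_of_mem hgK', Set.indicator_of_mem hgI, mul_one, mul_one, mul_one, sub_mul, add_mul,
    inv_toReal_measure_mul_toReal_measure ν K K₀ hK₀K hKo hKc hK₀o hK₀c, inv_toReal_measure_mul_toReal_measure ν K' K₀ hK₀K' hK'o hK'c hK₀o hK₀c,
    inv_toReal_measure_mul_toReal_measure ν I K₀ hK₀I hIo hIc hK₀o hK₀c]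

/-- **THE CENTRAL VALUE `−r` IN INDEX FORM**: if the three-term EP combination takes the value `−r` at some `z ∈ K ⊓ K′ ⊓ I` (★ `rankOneEulerPoincareNonsplit_withCentralValue`:
`f z = −r` at every scalar `z`), then `r · ν(K₀) = [I:K₀]⁻¹ − [K:K₀]⁻¹ − [K′:K₀]⁻¹` for every compact open `K₀ ≤ K ⊓ K′ ⊓ I` — the measure-free form of `r` that J3's R3
(«the two numbers») compares with the anisotropic sheet's mass. [cite: Kottwitz1988, §1; §2 Theorem 2] [cite: Rogawski1990, §8.1 p. 117; §12.6 p. 174] -/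
theorem mul_toReal_measure_eq_of_epCombination_apply_eq_neg (K K' I K₀ : Subgroup G)
    (hKo : IsOpen (K : Set G)) (hKc : IsCompact (K : Set G)) (hK'o : IsOpen (K' : Set G)) (hK'c : IsCompact (K' : Set G))
    (hIo : IsOpen (I : Set G)) (hIc : IsCompact (I : Set G)) (hK₀o : IsOpen (K₀ : Set G)) (hK₀c : IsCompact (K₀ : Set G))
    (hK₀K : K₀ ≤ K) (hK₀K' : K₀ ≤ K') (hK₀I : K₀ ≤ I) {z : G} (hzK : z ∈ K) (hzK' : z ∈ K') (hzI : z ∈ I) {r : ℂ}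
    (hfz : (((ν (K : Set G)).toReal : ℂ))⁻¹ * (K : Set G).indicator (fun _ => (1 : ℂ)) z + (((ν (K' : Set G)).toReal : ℂ))⁻¹ * (K' : Set G).indicator (fun _ => (1 : ℂ)) z -
        (((ν (I : Set G)).toReal : ℂ))⁻¹ * (I : Set G).indicator (fun _ => (1 : ℂ)) z = -r) :
    r * ((ν (K₀ : Set G)).toReal : ℂ) = ((K₀.relIndex I : ℕ) : ℂ)⁻¹ - ((K₀.relIndex K : ℕ) : ℂ)⁻¹ - ((K₀.relIndex K' : ℕ) : ℂ)⁻¹ := by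
  have h := epCombination_apply_mul_toReal_measure ν K K' I K₀ hKo hKc hK'o hK'c hIo hIc hK₀o hK₀c hK₀K hK₀K' hK₀I hzK hzK' hzI
  rw [hfz, neg_mul] at h
  linear_combination -h

end Summit.HodgeConjecture.HodgeConjecture.Cruxes.H413.K2E3EPValueIndexForm

end
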